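import Mathlib
import HarnessLib
import Summits.HubbardSuperconductivity.HubbardSuperconductivity.Theorems.WeakCouplingBCSKlCertTPrimeSoundnessWindow
import Summits.HubbardSuperconductivity.HubbardSuperconductivity.Theorems.WeakCouplingBCSKlCertTPrimeAnalyticOfEngineRows

/-!
# «(KLSCAN)-TPRIME-SOUNDNESS», engine-rows form: the `t′` WINDOW statement of an accepted record with the abstract analytic hypothesis
# `KLTPAnalytic` replaced by THREE ENGINE ROWS (speed floor, `χ₀` sup bound, one positive trial square-integral per rival channel)

Cell `gate-hubbard-kl`, seat margin-1 (g17); certificate half of stmt-HubbardSuperconductivity-0158 (`--supports`, helper).  p3's `kltp_window` / `kltp_window_U`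
(`Theorems/WeakCouplingBCSKlCertTPrimeSoundnessWindow.lean`) conclude `KLB1gDominatesAtTP tp mub mua gamma` / `KLB1gDominatesTP …` for a record `c` with
`c.checkB1gD = true` MODULO (a) the enclosures `c.EnclosuresB1gTP tp` and (b) `KLTPAnalytic (squareDispersion 1 tp) μ` for every `μ` of every box.  p4's
`klph_tprime_analytic_of_engineRows` (`Theorems/WeakCouplingBCSKlCertTPrimeAnalyticOfEngineRows.lean`) derives (b) from three statements an interval engine
certifies per cell.  This file composes them ONCE, generically in `tp` and `c`: the rows are (E1) a speed-square floor `0 < w ≤ ‖∇ε_{t′}‖²` on the Fermi curve,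
(E2) a sup bound `|χ₀[ε_{t′}](k + k′)| ≤ C` on `F × F`, (E3) for every channel `χ ≠ B1g` an index `i` into the record's trial table with `(klTab c.trials i).fits χ`
and `0 < ∫ (klTab c.trials i).toFun² dσ` — all per box, uniformly in `μ`; the `B1g` channel's positive trial is the record's own Ritz trial, whose `0 < Nlo ≤ ∫ Φ² dσ`
is part of `checkB1gD` + E1.  Ingredients: `klb1gd_coverLogic` (checker unpacking), `kl_tr_measurable_toFun`, `kl_tr_eval_bound`, `stub_klTrigChannel`
(`Theorems/ChiralWindowCwKLChiralWindowCertTrig.lean`).  No definitions; nothing here asserts any enclosure, any engine row, a margin, the window or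
superconductivity; a Kohn–Luttinger `O(U²)` channel statement is not ODLRO.
References: S. Raghu, S. A. Kivelson, D. J. Scalapino, Phys. Rev. B 81 (2010) 224505, §II (5)–(8), §III (17); M. Reed, B. Simon, *Methods of Modern Mathematical
Physics IV*, Thm. XIII.5.
-/

noncomputable section

-- the tree's namespace `Summit.<Summit>.<Problem>.Theorems` repeats the summit name by design (D-0017)
set_option linter.dupNamespace false

namespace Summit.HubbardSuperconductivity.HubbardSuperconductivity.Theorems

open MeasureTheory Real CwKLChiralWindow Literature.MathematicalPhysics.QuantumLattice

/-- A trigonometric polynomial of the polar angle is bounded on momentum space by the `ℓ¹` norm of its coefficients (value `0` at the origin).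
[folklore] -/
theorem kltp_tr_toFun_abs_le (t : KLTrig) (k : Momentum) :
    |t.toFun k| ≤ (t.cosC.map fun p : ℕ × ℚ => |(p.2 : ℝ)|).sum + (t.sinC.map fun p : ℕ × ℚ => |(p.2 : ℝ)|).sum := by
  have hnn : ∀ L : List (ℕ × ℚ), 0 ≤ (L.map fun p : ℕ × ℚ => |(p.2 : ℝ)|).sum := by
    intro L
    refine List.sum_nonneg ?_
    intro x hx
    obtain ⟨p, -, rfl⟩ := List.mem_map.1 hx
    exact abs_nonneg _
  unfold KLTrig.toFun
  split_ifs with h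
  · rw [abs_zero]; exact add_nonneg (hnn _) (hnn _)
  · exact kl_tr_eval_bound t _

/-- **An engine row of type E3 yields a channel witness**: a trigonometric polynomial in the harmonic pattern of `χ` with a positive square integral
against the Fermi-curve measure is a bounded, a.e.-strongly-measurable, in-channel function of positive norm — the third input of
`klph_tprime_analytic_of_engineRows`. [folklore] -/
theorem kltp_engineRow_trial (t : KLTrig) (χ : D4Irrep) (hfits : t.fits χ = true) {ε : Momentum → ℝ} {μ : ℝ}
    (hpos : 0 < ∫ k, t.toFun k ^ 2 ∂fermiCurveMeasure ε μ) :
    ∃ φ : Momentum → ℝ, ∃ B : ℝ, AEStronglyMeasurable φ (fermiCurveMeasure ε μ) ∧ (∀ k, |φ k| ≤ B) ∧ InChannel χ φ ∧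
      0 < ∫ k, φ k ^ 2 ∂fermiCurveMeasure ε μ :=
  ⟨t.toFun, _, (kl_tr_measurable_toFun t).aestronglyMeasurable, fun k => kltp_tr_toFun_abs_le t k, stub_klTrigChannel t χ hfits, hpos⟩

/-- **The `t′` window statement at every weak coupling from ENGINE ROWS** (generic in `tp` and in the record): an accepted record (`checkB1gD`), its `t′`
enclosures, and per box, uniformly in `μ`: (E1) a speed-square floor `0 < w ≤ (2 sin k₀ (1 + 2t′ cos k₁))² + (2 sin k₁ (1 + 2t′ cos k₀))²` on the Fermi curve,
(E2) `|χ₀[ε_{t′}](k + k′)| ≤ C` for `k, k′` on the Fermi curve, (E3) for every `χ ≠ B1g` a table index `i` with `(klTab c.trials i).fits χ` and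
`0 < ∫ (klTab c.trials i).toFun² dσ` — give `KLB1gDominatesTP tp mub mua gamma`.  The `B1g` witness is the record's Ritz trial (`ritzOK`: `fits B1g`, `0 < Nlo`;
E1: `Nlo ≤ ∫ Φ² dσ`). [cite: RaghuKivelsonScalapino2010, §II (5)-(8) and §III (17)] -/
theorem kltp_window_U_of_engineRows (tp : ℝ) (c : KLCert) (hc : c.checkB1gD = true) {w C : ℝ} (hw : 0 < w)
    (hspeed : ∀ bx ∈ c.boxes, ∀ μ ∈ Set.Icc (bx.mulo : ℝ) (bx.muhi : ℝ), ∀ k ∈ fermiCurve (squareDispersion 1 tp) μ,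
      w ≤ (2 * sin (k 0) * (1 + 2 * tp * cos (k 1))) ^ 2 + (2 * sin (k 1) * (1 + 2 * tp * cos (k 0))) ^ 2)
    (hC : ∀ bx ∈ c.boxes, ∀ μ ∈ Set.Icc (bx.mulo : ℝ) (bx.muhi : ℝ),
      ∀ k ∈ fermiCurve (squareDispersion 1 tp) μ, ∀ k' ∈ fermiCurve (squareDispersion 1 tp) μ,
        |lindhardFunction (squareDispersion 1 tp) μ (k + k')| ≤ C)
    (hpos : ∀ bx ∈ c.boxes, ∀ μ ∈ Set.Icc (bx.mulo : ℝ) (bx.muhi : ℝ), ∀ χ : D4Irrep, χ ≠ D4Irrep.B1g →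
      ∃ i : ℕ, (klTab c.trials i).fits χ = true ∧ 0 < ∫ k, (klTab c.trials i).toFun k ^ 2 ∂fermiCurveMeasure (squareDispersion 1 tp) μ)
    (hE : c.EnclosuresB1gTP tp) :
    KLB1gDominatesTP tp ((c.mub : ℚ) : ℝ) ((c.mua : ℚ) : ℝ) ((c.gamma : ℚ) : ℝ) := by
  refine kltp_window_U tp c hc (fun bx hbx μ hμ => ?_) hE
  obtain ⟨-, hboxes, -⟩ := klb1gd_coverLogic c hc
  have hB := (hboxes bx hbx).1
  simp only [KLBox.basicOKB1gD, Bool.and_eq_true, decide_eq_true_eq] at hB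
  obtain ⟨⟨⟨⟨⟨⟨⟨-, -⟩, -⟩, hritz⟩, -⟩, -⟩, -⟩, -⟩ := hB
  have hritz' := hritz
  simp only [KLBlock.ritzOK, Bool.and_eq_true, decide_eq_true_eq] at hritz'
  obtain ⟨⟨⟨⟨⟨⟨⟨-, -⟩, hfits⟩, hNlo⟩, -⟩, -⟩, -⟩, -⟩ := hritz'
  refine klph_tprime_analytic_of_engineRows tp μ hw (hspeed bx hbx μ hμ) (hC bx hbx μ hμ) (fun χ => ?_)
  by_cases hχ : χ = D4Irrep.B1g
  · subst hχ
    have hE1 : ((bx.bB1g.Nlo : ℚ) : ℝ) ≤ ∫ k, (klTab c.trials bx.bB1g.trial).toFun k ^ 2 ∂fermiCurveMeasure (squareDispersion 1 tp) μ :=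
      (hE bx hbx μ hμ).1.1
    have hNlo' : (0 : ℝ) < ((bx.bB1g.Nlo : ℚ) : ℝ) := by exact_mod_cast hNlo
    exact kltp_engineRow_trial _ _ hfits (hNlo'.trans_le hE1)
  · obtain ⟨i, hfits_i, hpos_i⟩ := hpos bx hbx μ hμ χ hχ
    exact kltp_engineRow_trial _ _ hfits_i hpos_i

/-- **The `U = 1` form from engine rows**: `KLB1gDominatesAtTP tp mub mua gamma` under the same rows and enclosures. [cite: RaghuKivelsonScalapino2010, §III (17)] -/
theorem kltp_window_of_engineRows (tp : ℝ) (c : KLCert) (hc : c.checkB1gD = true) {w C : ℝ} (hw : 0 < w)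
    (hspeed : ∀ bx ∈ c.boxes, ∀ μ ∈ Set.Icc (bx.mulo : ℝ) (bx.muhi : ℝ), ∀ k ∈ fermiCurve (squareDispersion 1 tp) μ,
      w ≤ (2 * sin (k 0) * (1 + 2 * tp * cos (k 1))) ^ 2 + (2 * sin (k 1) * (1 + 2 * tp * cos (k 0))) ^ 2)
    (hC : ∀ bx ∈ c.boxes, ∀ μ ∈ Set.Icc (bx.mulo : ℝ) (bx.muhi : ℝ),
      ∀ k ∈ fermiCurve (squareDispersion 1 tp) μ, ∀ k' ∈ fermiCurve (squareDispersion 1 tp) μ,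
        |lindhardFunction (squareDispersion 1 tp) μ (k + k')| ≤ C)
    (hpos : ∀ bx ∈ c.boxes, ∀ μ ∈ Set.Icc (bx.mulo : ℝ) (bx.muhi : ℝ), ∀ χ : D4Irrep, χ ≠ D4Irrep.B1g →
      ∃ i : ℕ, (klTab c.trials i).fits χ = true ∧ 0 < ∫ k, (klTab c.trials i).toFun k ^ 2 ∂fermiCurveMeasure (squareDispersion 1 tp) μ)
    (hE : c.EnclosuresB1gTP tp) :
    KLB1gDominatesAtTP tp ((c.mub : ℚ) : ℝ) ((c.mua : ℚ) : ℝ) ((c.gamma : ℚ) : ℝ) := by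
  refine kltp_window tp c hc (fun bx hbx μ hμ => ?_) hE
  obtain ⟨-, hboxes, -⟩ := klb1gd_coverLogic c hc
  have hB := (hboxes bx hbx).1
  simp only [KLBox.basicOKB1gD, Bool.and_eq_true, decide_eq_true_eq] at hB
  obtain ⟨⟨⟨⟨⟨⟨⟨-, -⟩, -⟩, hritz⟩, -⟩, -⟩, -⟩, -⟩ := hB
  have hritz' := hritz
  simp only [KLBlock.ritzOK, Bool.and_eq_true, decide_eq_true_eq] at hritz'
  obtain ⟨⟨⟨⟨⟨⟨⟨-, -⟩, hfits⟩, hNlo⟩, -⟩, -⟩, -⟩, -⟩ := hritz'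
  refine klph_tprime_analytic_of_engineRows tp μ hw (hspeed bx hbx μ hμ) (hC bx hbx μ hμ) (fun χ => ?_)
  by_cases hχ : χ = D4Irrep.B1g
  · subst hχ
    have hE1 : ((bx.bB1g.Nlo : ℚ) : ℝ) ≤ ∫ k, (klTab c.trials bx.bB1g.trial).toFun k ^ 2 ∂fermiCurveMeasure (squareDispersion 1 tp) μ :=
      (hE bx hbx μ hμ).1.1
    have hNlo' : (0 : ℝ) < ((bx.bB1g.Nlo : ℚ) : ℝ) := by exact_mod_cast hNlo
    exact kltp_engineRow_trial _ _ hfits (hNlo'.trans_le hE1)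
  · obtain ⟨i, hfits_i, hpos_i⟩ := hpos bx hbx μ hμ χ hχ
    exact kltp_engineRow_trial _ _ hfits_i hpos_i

end Summit.HubbardSuperconductivity.HubbardSuperconductivity.Theorems

end
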